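import Mathlib
import Literature.NumberTheory.LFunctions.Zhang2022.Section7aStatements
import Literature.NumberTheory.LFunctions.Zhang2022.Section8aStatements
import Literature.NumberTheory.LFunctions.Zhang2022.Section8Step8u012Prelims
import Literature.NumberTheory.LFunctions.DirichletLFunctionLowerBoundOffZeros
import HarnessLib

/-!
# Zhang (2022) §8 p. 43, step `Z22:§8.u016` — tools: the integrand `𝔠(s,ψ)A(s)Ā(1−s)ω(s)` of `I₁⁺`
# is holomorphic on the rectangle `[½+α, 3/2] × [2πt₀ − 𝓛₁, 2πt₀ + 𝓛₁]` and small on its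
# horizontal sides

Topic `Literature/NumberTheory/LFunctions/Zhang2022` (Landau–Siegel audit tree; verdict-neutral;
D-0069 campaign node **Z22:§8.u016**, [Z22 p.43, proof of Lemma 8.1, tex L2255–L2258]).
Y. Zhang, *Discrete mean estimates and the Landau–Siegel zero*, arXiv:2211.02515v1 (2022)
[Zhang2022LandauSiegel] — **an unrefereed manuscript under adjudication**:

> On the other hand, moving the segment `𝔍(α)` to `𝔍(1)` gives
> `Σ_{ψ∈Ψ₁} I₁⁺(𝐚₁,𝐚₂;ψ) = Θ₁(𝐚₁,𝐚₂) + O(ε)`.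

Here `I₁⁺ = (1/2πi)∫_{𝔍(α)} 𝔠(s,ψ)A(𝐚₁;s,ψ)A(𝐚₂,1−s,ψ̄)ω(s)ds` (`Section8aStatements.IonePlus`,
integrand `Section8aStatements.integrandC`), `Θ₁ = Σ_{ψ∈Ψ₁}(1/2πi)∫_{𝔍(1)}` of the same integrand
(`Skeleton.Theta1`), `𝔠(s,ψ) = −i(pt₀)^{β₃}Z(s,ψ)⁻¹L(s+β₁,ψ)L(s+β₂,ψ)L(s+β₃,ψ)/L(s,ψ)` (7.1). This file
provides the two analytic inputs of the move (theorems only; no definitions, no named facts):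

* `differentiableOn_integrandC` — for `ψ ∈ Ψ₁` the integrand is HOLOMORPHIC on the closed
  rectangle `R = [½+α, 3/2] × [2πt₀−𝓛₁, 2πt₀+𝓛₁]`: `L(·,ψ)`, `A`, `ω` are entire, `Z(s,ψ)` is analytic
  and zero-free on `Im s > 0` (tree `GammaFactor.differentiableAt_Zfac/Zfac_ne_zero`), and
  `L(s,ψ) ≠ 0` on `R` — for `σ ≥ 1` classically (Mathlib), for `½+α ≤ σ < 1` because `R ⊂ Ω` and
  "by Proposition 2.2" all zeros of `L(s,ψ)L(s,ψχ)` in `Ω` lie on `σ = ½`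
  (`LFunction_ne_zero_of_onLine`, hypothesis = the body of `Skeleton.Prop22i` at `ψ`);
* `norm_integrandC_le_on_edge` — on the horizontal sides `s = u + i(2πt₀ ± 𝓛₁)`, `½+α ≤ u ≤ 3/2`:
  `|integrand| ≤ e³(pt₀)·(p(T+5)Z)³·exp(C(1+log(1/α))(log p + log(T+4)))·(BN²)²·(√π/𝓛₂)e^{(1−𝓛₁²)/(4𝓛₂²)}`
  (`T = |Im s|`, `N = ⌈PT⁻²⌉`, `B` the bound of (7.2)), factor by factor: `|(pt₀)^{β₃}| = 1` (tree `Step8u012Holds.norm_cpow_beta3`);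
  `|Z(s,ψ)⁻¹| ≤ e³(pt₀)^{u−½}` (tree `Section7aStatements.norm_Zfac_inv_le`); `|L(s+β_j,ψ)| ≤ p(|t|+4)Z`
  (tree `DirichletDisc.norm_LFunction_le_of_mem_closedBall`); **`|L(s,ψ)|⁻¹ ≤ exp(C(1+log(1/α))ℒ)`
  by the tree's `DirichletDisc.exp_neg_le_norm_LFunction`** (all zeros in the Montgomery–Vaughan disc
  lie on `σ = ½`, at distance `≥ α` from the side); `|A|, |Ā(1−s)| ≤ BN²` (`norm_dirPoly_le`); and the
  Gaussian `|ω(s)| = (√π/𝓛₂)e^{(z²−𝓛₁²)/(4𝓛₂²)}`, `z = u − ½` (tree `SmoothWeight.norm_omega_segment_eq`).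

The deduction `Step8u016` itself (summing over `Ψ₁`, `(𝓛₁/𝓛₂)² = 𝓛¹⁰` against `P^{O(1)}e^{O(𝓛⁹log𝓛)}`)
is `Section8Step8u016.lean`. WHAT THIS IS NOT: any claim about Theorems 1–2 of the manuscript or
about Landau–Siegel zeros.

## References

* Y. Zhang, arXiv:2211.02515v1 (2022), §8 p.43 (proof of Lemma 8.1), §7 (7.1), §2 (2.15).
  [cite: Zhang2022LandauSiegel, §8 p.43, tex L2255–L2258]
-/

noncomputable section

open Complex Real Set Metric MeasureTheory
open Literature.NumberTheory.LFunctions.Zhang2022.Skeleton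
open Literature.NumberTheory.LFunctions.Zhang2022.Section8aStatements

namespace Literature.NumberTheory.LFunctions.Zhang2022.Step8u016

/-! ## A Dirichlet polynomial with bounded coefficients is polynomially bounded -/

/-- For `|a(n)| ≤ B` and `Re w ≥ −1`: `|Σ_{n<N} a(n)θ(n)n^{−w}| ≤ B·N²` (`|θ| ≤ 1`, `n^{−Re w} ≤ n ≤ N`).
[cite: Zhang2022LandauSiegel, §7 (7.2) p.32] -/
theorem norm_dirPoly_le {k : ℕ} [NeZero k] (N : ℕ) {a : ℕ → ℂ} {B : ℝ} (ha : ∀ n, ‖a n‖ ≤ B)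
    (θ : DirichletCharacter ℂ k) {w : ℂ} (hw : -1 ≤ w.re) :
    ‖Lemma81.dirPoly N a θ w‖ ≤ B * (N : ℝ) ^ 2 := by
  have hB : 0 ≤ B := (norm_nonneg _).trans (ha 0)
  rw [Lemma81.dirPoly_def]
  have hterm : ∀ n ∈ Finset.range N, ‖a n * θ (n : ZMod k) * (n : ℂ) ^ (-w)‖ ≤ B * N := by
    intro n hn
    have hnN : n < N := Finset.mem_range.mp hn
    have hN1 : (1 : ℝ) ≤ N := by exact_mod_cast Nat.one_le_of_lt hnN
    rw [norm_mul, norm_mul]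
    have h1 : ‖a n‖ * ‖θ (n : ZMod k)‖ ≤ B * 1 :=
      mul_le_mul (ha n) (θ.norm_le_one _) (norm_nonneg _) hB
    have h2 : ‖(n : ℂ) ^ (-w)‖ ≤ N := by
      rcases Nat.eq_zero_or_pos n with rfl | hn0
      · rw [Nat.cast_zero]
        by_cases h0 : -w = 0
        · rw [h0, cpow_zero, norm_one]; exact hN1
        · rw [Complex.zero_cpow h0, norm_zero]; exact le_trans zero_le_one hN1
      · rw [Complex.norm_natCast_cpow_of_pos hn0, Complex.neg_re]
        have hn1 : (1 : ℝ) ≤ n := by exact_mod_cast hn0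
        calc (n : ℝ) ^ (-w.re) ≤ (n : ℝ) ^ (1 : ℝ) :=
              Real.rpow_le_rpow_of_exponent_le hn1 (by linarith)
          _ = n := Real.rpow_one _
          _ ≤ N := by exact_mod_cast hnN.le
    calc ‖a n‖ * ‖θ (n : ZMod k)‖ * ‖(n : ℂ) ^ (-w)‖ ≤ B * 1 * N :=
          mul_le_mul h1 h2 (norm_nonneg _) (by positivity)
      _ = B * N := by ring
  calc ‖∑ n ∈ Finset.range N, a n * θ (n : ZMod k) * (n : ℂ) ^ (-w)‖
      ≤ ∑ n ∈ Finset.range N, ‖a n * θ (n : ZMod k) * (n : ℂ) ^ (-w)‖ := norm_sum_le _ _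
    _ ≤ ∑ n ∈ Finset.range N, B * N := Finset.sum_le_sum hterm
    _ = B * (N : ℝ) ^ 2 := by rw [Finset.sum_const, Finset.card_range, nsmul_eq_mul]; ring

/-! ## Zero-free input: "by Proposition 2.2" the zeros of `L(s,ψ)` near the window lie on `σ = ½` -/

section ZeroFree

variable {D : ℕ} [NeZero D] {χ : DirichletCharacter ℂ D} {x : Chr D}

omit [NeZero D] in
/-- The window `Ω` in coordinates: `s ∈ Ω` iff `|σ − ½| < ½` and `|t − 2πt₀| < 𝓛₁ + 2`.
[cite: Zhang2022LandauSiegel, §2 (2.7)] -/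
private theorem mem_Omega_iff (s : ℂ) :
    s ∈ Omega D ↔ |s.re - 1 / 2| < 1 / 2 ∧ |s.im - 2 * π * t0 D| < ell1 D + 2 := by
  simp [Omega, s0, SmoothWeight.s0]

/-- **`L(s,ψ) ≠ 0` to the right of the critical line inside the window**: if all zeros of
`L(s,ψ)L(s,ψχ)` in `Ω` lie on `σ = ½` (the body of Proposition 2.2 (i) at `ψ`), then `L(s,ψ) ≠ 0` for
`σ > ½`, `|t − 2πt₀| < 𝓛₁ + 2` (for `σ ≥ 1` this is classical, Mathlib's
`DirichletCharacter.LFunction_ne_zero_of_one_le_re`). [cite: Zhang2022LandauSiegel, §8 p.42 («By Proposition 2.2»)] -/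
theorem LFunction_ne_zero_of_onLine (h22 : ∀ s ∈ prodZeroSetOmega χ x, s.re = 1 / 2) {s : ℂ}
    (hre : 1 / 2 < s.re) (him : |s.im - 2 * π * t0 D| < ell1 D + 2) : x.ψ.LFunction s ≠ 0 := by
  intro h0
  rcases le_or_gt 1 s.re with h1 | h1
  · exact DirichletCharacter.LFunction_ne_zero_of_one_le_re x.ψ (Or.inl x.ψ_ne_one) h1 h0
  · have hΩ : s ∈ Omega D := by
      rw [mem_Omega_iff]
      refine ⟨?_, him⟩
      rw [abs_lt]; constructor <;> linarith
    have hmem : s ∈ prodZeroSetOmega χ x := ⟨hΩ, by rw [h0, zero_mul]⟩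
    have := h22 s hmem
    linarith

/-- **The zeros of `L(s,ψ)` in the Montgomery–Vaughan disc `|ρ − (2+it)| ≤ 81/50`, `|t − 2πt₀| ≤ 𝓛₁`,
lie on `σ = ½`** (they belong to `Ω`, where Proposition 2.2 (i) applies).
[cite: Zhang2022LandauSiegel, §8 p.42 («By Proposition 2.2»)] -/
theorem discZeros_re_eq_half (h22 : ∀ s ∈ prodZeroSetOmega χ x, s.re = 1 / 2) {t : ℝ}
    (ht : |t - 2 * π * t0 D| ≤ ell1 D) :
    ∀ ρ ∈ DirichletDisc.discZeros x.ψ t, ρ.re = 1 / 2 := by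
  intro ρ hρ
  obtain ⟨h0, him, hre1, hre2, -, -⟩ := DirichletDisc.discZeros_prop x.ψ_ne_one hρ
  have hΩ : ρ ∈ Omega D := by
    rw [mem_Omega_iff]
    constructor
    · rw [abs_lt]; constructor <;> linarith
    · have h1 : |ρ.im - 2 * π * t0 D| ≤ |ρ.im - t| + |t - 2 * π * t0 D| := abs_sub_le _ _ _
      have h2 : (81 : ℝ) / 50 < 2 := by norm_num
      linarith
  exact h22 ρ ⟨hΩ, by rw [h0, zero_mul]⟩

end ZeroFree

/-! ## Holomorphy of the integrand on the rectangle -/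

section Holomorphy

variable (c' : ℝ) {D : ℕ} [NeZero D] {χ : DirichletCharacter ℂ D} (x : Chr D)

omit [NeZero D] in
/-- `𝔠(s,ψ)` (7.1) is complex-differentiable at every `s` with `Im s > 0` and `L(s,ψ) ≠ 0`.
[cite: Zhang2022LandauSiegel, §7 (7.1)] -/
theorem differentiableAt_frakcW {s : ℂ} (him : 0 < s.im) (hL : x.ψ.LFunction s ≠ 0) :
    DifferentiableAt ℂ (frakcW c' x) s := by
  have hfun : frakcW c' x = fun s =>
      -I * (((x.p : ℝ) * t0 D : ℝ) : ℂ) ^ beta3 c' D * (GammaFactor.Zfac x.ψ s)⁻¹ *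
        (x.ψ.LFunction (s + beta1 c' D) * x.ψ.LFunction (s + beta2 c' D) *
          x.ψ.LFunction (s + beta3 c' D)) / x.ψ.LFunction s := by
    funext s; rfl
  rw [hfun]
  have hLd := DirichletCharacter.differentiable_LFunction x.ψ_ne_one
  have hZ : DifferentiableAt ℂ (fun s => (GammaFactor.Zfac x.ψ s)⁻¹) s :=
    (GammaFactor.differentiableAt_Zfac x.ψ him).inv (GammaFactor.Zfac_ne_zero x.prim him)
  have hL1 : DifferentiableAt ℂ (fun s => x.ψ.LFunction (s + beta1 c' D)) s :=
    (hLd.comp (differentiable_id.add_const _)).differentiableAt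
  have hL2 : DifferentiableAt ℂ (fun s => x.ψ.LFunction (s + beta2 c' D)) s :=
    (hLd.comp (differentiable_id.add_const _)).differentiableAt
  have hL3 : DifferentiableAt ℂ (fun s => x.ψ.LFunction (s + beta3 c' D)) s :=
    (hLd.comp (differentiable_id.add_const _)).differentiableAt
  have hL0 : DifferentiableAt ℂ (fun s => x.ψ.LFunction s) s := hLd.differentiableAt
  exact ((((differentiableAt_const _).mul hZ).mul ((hL1.mul hL2).mul hL3)).div hL0 hL)

/-- **The integrand of `I₁⁺`/`Θ₁` is holomorphic on the closed rectangle
`[½+α, 3/2] × [2πt₀−𝓛₁, 2πt₀+𝓛₁]`** for `ψ ∈ Ψ₁` (zeros on the line, `0 < α ≤ 1`, `𝓛₁ < 2πt₀`).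
[cite: Zhang2022LandauSiegel, §8 p.43, tex L2255–L2258] -/
theorem differentiableOn_integrandC (h22 : ∀ s ∈ prodZeroSetOmega χ x, s.re = 1 / 2)
    (hα0 : 0 < alpha D) (hα1 : alpha D ≤ 1) (hwin : ell1 D < 2 * π * t0 D) (a₁ a₂ : ℕ → ℂ) :
    DifferentiableOn ℂ (integrandC c' x a₁ a₂)
      (Set.uIcc (1 / 2 + alpha D) (1 / 2 + 1) ×ℂ
        Set.uIcc (2 * π * t0 D - ell1 D) (2 * π * t0 D + ell1 D)) := by
  intro s hs
  have hre : 1 / 2 + alpha D ≤ s.re ∧ s.re ≤ 1 / 2 + 1 := by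
    have h := hs.1
    rw [Set.uIcc_of_le (by linarith)] at h
    exact h
  have him : 2 * π * t0 D - ell1 D ≤ s.im ∧ s.im ≤ 2 * π * t0 D + ell1 D := by
    have h := hs.2
    rw [Set.uIcc_of_le (by linarith [show 0 ≤ ell1 D from pow_nonneg (Real.log_natCast_nonneg D) _])]
      at h
    exact h
  have hℓ1 : 0 ≤ ell1 D := pow_nonneg (Real.log_natCast_nonneg D) _
  have him0 : 0 < s.im := by linarith
  have himw : |s.im - 2 * π * t0 D| < ell1 D + 2 := by
    rw [abs_lt]; constructor <;> linarith
  have hL : x.ψ.LFunction s ≠ 0 := LFunction_ne_zero_of_onLine h22 (by linarith) himw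
  have hfun : integrandC c' x a₁ a₂ = fun s =>
      frakcW c' x s * Apoly x a₁ s * ApolyBar x a₂ (1 - s) * omegaW D s := by
    funext s; rfl
  rw [hfun]
  refine DifferentiableAt.differentiableWithinAt ?_
  exact (((differentiableAt_frakcW c' x him0 hL).mul
    ((Section7aStatements.differentiable_Apoly x a₁).differentiableAt)).mul
    ((Section7aStatements.differentiable_ApolyBar_one_sub x a₂).differentiableAt)).mul
    ((Section7aStatements.differentiable_omegaW D).differentiableAt)

end Holomorphy

/-! ## The size of the integrand on the horizontal sides -/

section EdgeBound

variable (c' : ℝ) {D : ℕ} [NeZero D] {χ : DirichletCharacter ℂ D} (x : Chr D)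

omit [NeZero D] in
/-- The shifts are small: `|b_j| ≤ 1` once `α ≤ 1/6` and `|c′|α𝓛 ≤ 1` (sizes (2.13)).
[cite: Zhang2022LandauSiegel, §2 (2.13)] -/
theorem abs_b_le_one (hα0 : 0 ≤ alpha D) (hα : alpha D ≤ 1 / 6) (hc : |c'| * (alpha D * ell D) ≤ 1) :
    |b1 c' D| ≤ 1 ∧ |b2 c' D| ≤ 1 ∧ |b3 c' D| ≤ 1 := by
  have hαℓ : 0 ≤ alpha D * ell D := mul_nonneg hα0 (Real.log_natCast_nonneg D)
  have h1 : |c' * (alpha D * ell D)| ≤ 1 := by rwa [abs_mul, abs_of_nonneg hαℓ]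
  have hc1 := abs_le.mp h1
  refine ⟨?_, ?_, ?_⟩
  · rw [b1, abs_le]; constructor <;> nlinarith
  · rw [b2, abs_le]; constructor <;> nlinarith
  · rw [b3, abs_le]; constructor <;> nlinarith

omit [NeZero D] in
/-- **`|L(s + β_j, ψ)| ≤ p(|t| + 5)Z`** for `½ ≤ Re s ≤ 2` and `|b_j| ≤ 1` (the tree's crude bound
`|L(z,χ)| ≤ q(|t′|+4)Z` on the Montgomery–Vaughan discs, `t′ = t + b_j`).
[cite: MontgomeryVaughan2007, Lemma 10.15] -/
theorem norm_LFunction_shift_le {s : ℂ} (hre : s.re ∈ Icc (1 / 2 : ℝ) 2) {b : ℝ} (hb : |b| ≤ 1) :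
    ‖x.ψ.LFunction (s + (b : ℂ) * I)‖ ≤ x.p * (|s.im| + 5) * DirichletDisc.Zc := by
  have hs : s + (b : ℂ) * I = (s.re : ℂ) + ((s.im + b : ℝ) : ℂ) * I := by
    apply Complex.ext <;> simp
  have hmem : (s.re : ℂ) + ((s.im + b : ℝ) : ℂ) * I ∈
      closedBall (2 + ((s.im + b : ℝ) : ℂ) * I) (38 / 25) :=
    DirichletDisc.mem_closedBall_of_re_mem_Icc hre (by simp)
  have hmem' : s + (b : ℂ) * I ∈ closedBall (2 + ((s.im + b : ℝ) : ℂ) * I) (7 / 4) := by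
    rw [hs]; exact closedBall_subset_closedBall (by norm_num) hmem
  have h := DirichletDisc.norm_LFunction_le_of_mem_closedBall x.ψ x.ψ_ne_one (s.im + b) hmem'
  refine h.trans ?_
  have hZ : 0 ≤ DirichletDisc.Zc := le_trans zero_le_one DirichletDisc.one_le_Zc
  have h1 : |s.im + b| + 4 ≤ |s.im| + 5 := by
    have := abs_add_le s.im b; linarith
  have hp : (0 : ℝ) ≤ x.p := Nat.cast_nonneg _
  gcongr

/-- **The integrand on the horizontal sides.** Let `ψ ∈ Ψ₁` with the zeros of `L(s,ψ)L(s,ψχ)` in `Ω`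
on the line, `D ≥ 3`, `0 < α ≤ 1/6`, `|c′|α𝓛 ≤ 1`, `(7.2)` for `𝐚₁, 𝐚₂` with the bound `B`, and
`s = u + it` with `½+α ≤ u ≤ 3/2`, `|t − 2πt₀| = 𝓛₁`… more precisely `|t − 2πt₀| ≤ 𝓛₁` and `t ≥ 1`. Then
`|𝔠(s,ψ)A(𝐚₁;s)A(𝐚₂,1−s)ω(s)| ≤ [e³(pt₀)]·[p(|t|+5)Z]³·exp(C(1+log(1/α))(log p + log(|t|+4)))
 ·(BN²)²·(√π/𝓛₂)·exp(((u−½)² − (t−2πt₀)²)/(4𝓛₂²))`, `C` the absolute constant of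
`DirichletDisc.exp_neg_le_norm_LFunction`, `N = ⌈PT⁻²⌉`. [cite: Zhang2022LandauSiegel, §8 p.43, tex L2255–L2258] -/
theorem norm_integrandC_le {C : ℝ}
    (hC : ∀ (q : ℕ) [NeZero q] (θ : DirichletCharacter ℂ q), θ ≠ 1 → ∀ t σ d : ℝ,
      1 / 2 ≤ σ → σ ≤ 2 → 0 < d → d ≤ 1 →
        (∀ ρ ∈ DirichletDisc.discZeros θ t, ∀ y ∈ Icc σ 2, d ≤ ‖(y : ℂ) + t * I - ρ‖) →
          Real.exp (-(C * (1 + Real.log (1 / d)) * (Real.log q + Real.log (|t| + 4)))) ≤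
            ‖θ.LFunction ((σ : ℂ) + t * I)‖)
    (h22 : ∀ s ∈ prodZeroSetOmega χ x, s.re = 1 / 2) (hD : 3 ≤ D)
    (hα0 : 0 < alpha D) (hα : alpha D ≤ 1 / 6) (hc : |c'| * (alpha D * ell D) ≤ 1)
    {B : ℝ} {a₁ a₂ : ℕ → ℂ} (ha₁ : Adm72 D B a₁) (ha₂ : Adm72 D B a₂)
    {u t : ℝ} (hu1 : 1 / 2 + alpha D ≤ u) (hu2 : u ≤ 3 / 2) (ht : |t - 2 * π * t0 D| ≤ ell1 D)
    (ht1 : 1 ≤ t) :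
    ‖integrandC c' x a₁ a₂ ((u : ℂ) + t * I)‖ ≤
      (Real.exp 3 * ((x.p : ℝ) * t0 D)) * ((x.p : ℝ) * (|t| + 5) * DirichletDisc.Zc) ^ 3 *
        Real.exp (C * (1 + Real.log (1 / alpha D)) * (Real.log x.p + Real.log (|t| + 4))) *
        (B * (Nsupp D : ℝ) ^ 2) ^ 2 *
        (Real.sqrt π / ell2 D * Real.exp (((u - 1 / 2) ^ 2 - (t - 2 * π * t0 D) ^ 2) /
          (4 * ell2 D ^ 2))) := by
  set s : ℂ := (u : ℂ) + t * I with hs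
  have hsre : s.re = u := by simp [hs]
  have hsim : s.im = t := by simp [hs]
  have ht0 : 0 < t := by linarith
  have hp0 : (0 : ℝ) < x.p := by exact_mod_cast x.prime.pos
  have hp1 : (1 : ℝ) ≤ x.p := by exact_mod_cast x.prime.one_lt.le
  have hℓ : 1 ≤ ell D := (one_lt_ell hD).le
  have ht0D : 0 < t0 D := pow_pos (by linarith) _
  have hpt : 1 ≤ (x.p : ℝ) * t0 D := by
    have : 1 ≤ t0 D := by rw [t0]; exact one_le_pow₀ hℓ
    nlinarith
  have hZc : 1 ≤ DirichletDisc.Zc := DirichletDisc.one_le_Zc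
  have hB : 0 ≤ B := (norm_nonneg _).trans (ha₁.1 0)
  obtain ⟨hb1, hb2, hb3⟩ := abs_b_le_one c' hα0.le hα hc
  obtain ⟨e1, e2, e3⟩ := beta_eq_b_mul_I c' D
  -- the factors of `𝔠`
  have hF1 : ‖-I * (((x.p : ℝ) * t0 D : ℝ) : ℂ) ^ beta3 c' D‖ = 1 := by
    rw [norm_mul, norm_neg, Complex.norm_I, one_mul, Step8u012Holds.norm_cpow_beta3 x ht0D]
  have hF2 : ‖(GammaFactor.Zfac x.ψ s)⁻¹‖ ≤ Real.exp 3 * ((x.p : ℝ) * t0 D) := by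
    have h := Section7aStatements.norm_Zfac_inv_le hD x (s := s) (by rw [hsre]; linarith)
      (by rw [hsre]; nlinarith [one_le_pow₀ (M₀ := ℝ) hℓ (n := 9)]) (by rw [hsim]; exact ht)
    refine h.trans ?_
    rw [hsre]
    have hexp : ((x.p : ℝ) * t0 D) ^ (u - 1 / 2) ≤ ((x.p : ℝ) * t0 D) ^ (1 : ℝ) :=
      Real.rpow_le_rpow_of_exponent_le hpt (by linarith)
    rw [Real.rpow_one] at hexp
    exact mul_le_mul_of_nonneg_left hexp (Real.exp_pos 3).le
  have hreI : s.re ∈ Icc (1 / 2 : ℝ) 2 := by rw [hsre]; constructor <;> linarith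
  have hL1 : ‖x.ψ.LFunction (s + beta1 c' D)‖ ≤ x.p * (|t| + 5) * DirichletDisc.Zc := by
    rw [e1, ← hsim]; exact norm_LFunction_shift_le x hreI hb1
  have hL2 : ‖x.ψ.LFunction (s + beta2 c' D)‖ ≤ x.p * (|t| + 5) * DirichletDisc.Zc := by
    rw [e2, ← hsim]; exact norm_LFunction_shift_le x hreI hb2
  have hL3 : ‖x.ψ.LFunction (s + beta3 c' D)‖ ≤ x.p * (|t| + 5) * DirichletDisc.Zc := by
    rw [e3, ← hsim]; exact norm_LFunction_shift_le x hreI hb3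
  -- the lower bound for `L(s,ψ)`: all disc zeros are on the line, at distance `≥ α` from `[u, 2] + it`
  have hα1 : alpha D ≤ 1 := by linarith
  have hdist := DirichletDisc.dist_segment_of_re_le (χ := x.ψ) (t := t) (σ := u) (d := alpha D)
    (fun ρ hρ => by rw [discZeros_re_eq_half h22 ht ρ hρ]; linarith)
  have hLlow := hC x.p x.ψ x.ψ_ne_one t u (alpha D) (by linarith) (by linarith) hα0 hα1 hdist
  set E : ℝ := Real.exp (C * (1 + Real.log (1 / alpha D)) * (Real.log x.p + Real.log (|t| + 4)))
    with hE
  have hE0 : 0 < E := Real.exp_pos _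
  have hLs0 : 0 < ‖x.ψ.LFunction s‖ := lt_of_lt_of_le (Real.exp_pos _) hLlow
  have hF4 : ‖(x.ψ.LFunction s)⁻¹‖ ≤ E := by
    rw [norm_inv, inv_le_comm₀ hLs0 hE0, hE, ← Real.exp_neg]
    exact hLlow
  -- the Dirichlet polynomials and the weight
  have hA1 : ‖Apoly x a₁ s‖ ≤ B * (Nsupp D : ℝ) ^ 2 :=
    norm_dirPoly_le (Nsupp D) ha₁.1 x.ψ (by rw [hsre]; linarith)
  have hA2 : ‖ApolyBar x a₂ (1 - s)‖ ≤ B * (Nsupp D : ℝ) ^ 2 :=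
    norm_dirPoly_le (Nsupp D) ha₂.1 x.ψ⁻¹ (by simp [hsre]; linarith)
  have hℓ2 : 0 < ell2 D := pow_pos (by linarith) _
  have hω : ‖omegaW D s‖ = Real.sqrt π / ell2 D *
      Real.exp (((u - 1 / 2) ^ 2 - (t - 2 * π * t0 D) ^ 2) / (4 * ell2 D ^ 2)) := by
    have hs' : s = ((u - 1 / 2 : ℝ) : ℂ) + SmoothWeight.s0 (t0 D) + ((t - 2 * π * t0 D : ℝ) : ℂ) * I := by
      rw [hs, SmoothWeight.s0_def]; push_cast; ring
    rw [omegaW, hs', SmoothWeight.norm_omega_segment_eq hℓ2]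
  -- assembly
  have hfun : integrandC c' x a₁ a₂ s = (-I * (((x.p : ℝ) * t0 D : ℝ) : ℂ) ^ beta3 c' D) *
      (GammaFactor.Zfac x.ψ s)⁻¹ *
      (x.ψ.LFunction (s + beta1 c' D) * x.ψ.LFunction (s + beta2 c' D) *
        x.ψ.LFunction (s + beta3 c' D)) * (x.ψ.LFunction s)⁻¹ *
      Apoly x a₁ s * ApolyBar x a₂ (1 - s) * omegaW D s := by
    rw [integrandC, frakcW, div_eq_mul_inv]
  rw [hfun, norm_mul, norm_mul, norm_mul, norm_mul, norm_mul, norm_mul, hF1, one_mul,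
    norm_mul, norm_mul, hω]
  have hPZ : 0 ≤ (x.p : ℝ) * (|t| + 5) * DirichletDisc.Zc :=
    mul_nonneg (mul_nonneg hp0.le (by positivity)) (le_trans zero_le_one hZc)
  have hL123 : ‖x.ψ.LFunction (s + beta1 c' D)‖ * ‖x.ψ.LFunction (s + beta2 c' D)‖ *
      ‖x.ψ.LFunction (s + beta3 c' D)‖ ≤ ((x.p : ℝ) * (|t| + 5) * DirichletDisc.Zc) ^ 3 := by
    rw [pow_three']
    exact mul_le_mul (mul_le_mul hL1 hL2 (norm_nonneg _) hPZ) hL3 (norm_nonneg _)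
      (mul_nonneg hPZ hPZ)
  have hAA : ‖Apoly x a₁ s‖ * ‖ApolyBar x a₂ (1 - s)‖ ≤ (B * (Nsupp D : ℝ) ^ 2) ^ 2 := by
    rw [show (B * (Nsupp D : ℝ) ^ 2) ^ 2 = (B * (Nsupp D : ℝ) ^ 2) * (B * (Nsupp D : ℝ) ^ 2) from
      pow_two _]
    exact mul_le_mul hA1 hA2 (norm_nonneg _) (mul_nonneg hB (sq_nonneg _))
  have hω0 : 0 ≤ Real.sqrt π / ell2 D *
      Real.exp (((u - 1 / 2) ^ 2 - (t - 2 * π * t0 D) ^ 2) / (4 * ell2 D ^ 2)) :=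
    mul_nonneg (div_nonneg (Real.sqrt_nonneg _) hℓ2.le) (Real.exp_pos _).le
  calc ‖(GammaFactor.Zfac x.ψ s)⁻¹‖ *
        (‖x.ψ.LFunction (s + beta1 c' D)‖ * ‖x.ψ.LFunction (s + beta2 c' D)‖ *
          ‖x.ψ.LFunction (s + beta3 c' D)‖) * ‖(x.ψ.LFunction s)⁻¹‖ *
        ‖Apoly x a₁ s‖ * ‖ApolyBar x a₂ (1 - s)‖ *
        (Real.sqrt π / ell2 D *
          Real.exp (((u - 1 / 2) ^ 2 - (t - 2 * π * t0 D) ^ 2) / (4 * ell2 D ^ 2)))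
      = ‖(GammaFactor.Zfac x.ψ s)⁻¹‖ *
        (‖x.ψ.LFunction (s + beta1 c' D)‖ * ‖x.ψ.LFunction (s + beta2 c' D)‖ *
          ‖x.ψ.LFunction (s + beta3 c' D)‖) * ‖(x.ψ.LFunction s)⁻¹‖ *
        (‖Apoly x a₁ s‖ * ‖ApolyBar x a₂ (1 - s)‖) *
        (Real.sqrt π / ell2 D *
          Real.exp (((u - 1 / 2) ^ 2 - (t - 2 * π * t0 D) ^ 2) / (4 * ell2 D ^ 2))) := by ring
    _ ≤ (Real.exp 3 * ((x.p : ℝ) * t0 D)) * ((x.p : ℝ) * (|t| + 5) * DirichletDisc.Zc) ^ 3 * E *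
        (B * (Nsupp D : ℝ) ^ 2) ^ 2 *
        (Real.sqrt π / ell2 D *
          Real.exp (((u - 1 / 2) ^ 2 - (t - 2 * π * t0 D) ^ 2) / (4 * ell2 D ^ 2))) := by
        have hZb : 0 ≤ Real.exp 3 * ((x.p : ℝ) * t0 D) :=
          mul_nonneg (Real.exp_pos 3).le (le_trans zero_le_one hpt)
        have hLb : 0 ≤ ((x.p : ℝ) * (|t| + 5) * DirichletDisc.Zc) ^ 3 := pow_nonneg hPZ 3
        have hAb : 0 ≤ (B * (Nsupp D : ℝ) ^ 2) ^ 2 := sq_nonneg _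
        have h1 : ‖(GammaFactor.Zfac x.ψ s)⁻¹‖ *
            (‖x.ψ.LFunction (s + beta1 c' D)‖ * ‖x.ψ.LFunction (s + beta2 c' D)‖ *
              ‖x.ψ.LFunction (s + beta3 c' D)‖) ≤
            Real.exp 3 * ((x.p : ℝ) * t0 D) * ((x.p : ℝ) * (|t| + 5) * DirichletDisc.Zc) ^ 3 :=
          mul_le_mul hF2 hL123 (by positivity) hZb
        have h2 := mul_le_mul h1 hF4 (norm_nonneg _) (mul_nonneg hZb hLb)
        have h3 := mul_le_mul h2 hAA (by positivity) (mul_nonneg (mul_nonneg hZb hLb) hE0.le)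
        exact mul_le_mul_of_nonneg_right h3 hω0

end EdgeBound

end Literature.NumberTheory.LFunctions.Zhang2022.Step8u016

end
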